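import Summits.Parity.GeneralizedHardyLittlewood.Theorems.PrimeLevelFamEdgeMomentsBeyondDiagonalDiagRemTwoFourProfile
import Summits.Parity.GeneralizedHardyLittlewood.Theorems.PrimeLevelFamEdgeMomentsBeyondDiagonalDiagRemTwoFourKernelsAll
import Summits.Parity.GeneralizedHardyLittlewood.Theorems.PrimeLevelFamEdgeMomentsBeyondDiagonalDiagRemThreeThreeInner
import HarnessLib

/-!
# Route `PrimeLevelFamEdge`, crux K_A `MomentsBeyondDiagonal` (stmt-Parity-20007), line «petersson_layers» v4, stub `stub_diag`:
# **the inner `(k₁,k₂)` sum of the ORDER-`(2,4)` remainder estimate (R₂₄), for fixed Selberg coordinates `(c,g)`** (brick B4)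

Brick B4 of (R₂₄) — the hypothesis `hR` of `…DiagOrderTwoFourOfR24.orderTwoFour_target_of_remainder` (lineage famedge-2 g7). The
order-`(3,3)` inner file `…DiagRemThreeThreeInner` (p835434) re-run with the fifteen kernels of `…DiagRemTwoFourKernelsAll.twoSeq_fifteen₂₄`,
the bookkeeping `…DiagRemTwoFourProfile.abs_profile_weight_le₂₄` (six envelopes: undecorated, `P₂`-, `D₄`-, `D₆`-columns,
both-sided `P₂⊗P₂` for the six kernels `r_ab`, `a+b ≤ 2` (`…DiagRemBothSidedPow.abs_bothsided_primeSq_le_pow 14`), mixed `P₂⊗D₄·r₀₀`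
(`…DiagRemBothSidedMixedPow`)), the row saving `…DiagRemLogSavingPow.abs_sum_copTauW_le_pow 14` and the closing inequality
`…DiagRemThreeThreeEnvelopeArith.envelope_arith₃₃` VERBATIM (the order-`(2,4)` monomial constants are below the order-`(3,3)` ones; the
homogeneous weight is `6` again, budget `Λ¹⁶·D(n)²`):

* `abs_inner_rem_le₂₄` — **the inner estimate**: for `n, g ≥ 1`, `Q, M ≥ 2`, `n, g ≤ M`, `Y = M/n`, `α = g²/Q²`, `2αK₁Y ≤ 1`:
  `|Σ_{k₁,k₂≤Y} a_n(k₁)P(ℓ⁺₁/log M)a_n(k₂)P(ℓ⁺₂/log M)·Wt₂₄(k₁,k₂)| ≤ C·D(n)²·Λ¹⁶·(√(2αK₁Y) + (1+log K₁)⁻¹⁴)`,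
  `Λ = 1 + 2log M + log Q`, moments `μ₂, μ₄, μ₆`.

Def-free; theorems only. Helper `--supports stmt-Parity-20007`; closes nothing (brick B5 = assembly of (R₂₄) remains; the order `(4,4)`
and `stub_rung/core/band/farP` remain); K_A, K_B and the Parity summit are NOT proved; nothing about Landau–Siegel zeros.

## References
* E. Kowalski, P. Michel, J. VanderKam, J. reine angew. Math. 526 (2000), (22)–(28) pp. 12–15 and Prop. 5.1 p. 18.
  [cite: KowalskiMichelVanderKam2000, (23)–(28) and Prop. 5.1 — derivation (order-(2,4) remainder, inner sums)]
-/

noncomputable section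

open scoped Real ArithmeticFunction.Moebius
open Finset ArithmeticFunction Polynomial Real MeasureTheory

namespace Summit.Parity.GeneralizedHardyLittlewood.Theorems.MomentsBeyondDiagonal.DiagCorner

open Literature.NumberTheory.LFunctions Literature.NumberTheory.LFunctions.KMV2000
open MollifierMainTerm (W)
open Summit.Parity.GeneralizedHardyLittlewood.Theorems.BeyondDiagonalBeatsQuarter.KernelFormXSq
  (copTauW copTauW_apply divWeight divWeight_nonneg one_le_divWeight abs_W_le)
open Summit.Parity.GeneralizedHardyLittlewood.Theorems.BeyondDiagonalBeatsQuarter.Corner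
open Summit.Parity.GeneralizedHardyLittlewood.Theorems.MomentsBeyondDiagonal.DiagLines

set_option maxHeartbeats 3200000 in
set_option maxRecDepth 8192 in
-- fifteen remainders, six decoration types, large statement
/-- **The inner `(k₁,k₂)` sum of the order-`(2,4)` remainder estimate (R₂₄) for fixed `(c,g)`** (see the module docstring).
[cite: KowalskiMichelVanderKam2000, (23)–(28) and Prop. 5.1 — derivation (order-(2,4) remainder, inner sums)] -/
theorem abs_inner_rem_le₂₄ : ∃ E₀₀ E₀₁ E₀₂ E₀₃ E₀₄ E₁₀ E₁₁ E₁₂ E₁₃ E₁₄ E₂₀ E₂₁ E₂₂ E₂₃ E₂₄ μ₂ μ₄ μ₆ : ℝ, ∀ P : ℝ[X], P.coeff 0 = 0 → ∃ C : ℝ, 0 < C ∧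
    ∀ (n g : ℕ), n ≠ 0 → g ≠ 0 → ∀ (Q M : ℝ), 2 ≤ Q → 2 ≤ M → (n : ℝ) ≤ M → (g : ℝ) ≤ M → ∀ K₁ : ℕ,
      2 * ((g : ℝ) ^ 2 / Q ^ 2) * K₁ * (M / n) ≤ 1 →
    |∑ k₁ ∈ Icc 1 ⌊M / n⌋₊, ∑ k₂ ∈ Icc 1 ⌊M / n⌋₊,
        copTauW n k₁ * P.eval (ellp (M / n) k₁ / Real.log M) * (copTauW n k₂ * P.eval (ellp (M / n) k₂ / Real.log M)) *
          (((2 * (Real.log Q - Real.log g) - Real.log k₁ - Real.log k₂) ^ 6 - (2 * (Real.log Q - Real.log g) - Real.log k₁ - Real.log k₂) ^ 4 * ((∑ p ∈ k₁.primeFactors, Real.log p ^ 2) + ∑ p ∈ k₂.primeFactors, Real.log p ^ 2) - 3 * (2 * (Real.log Q - Real.log g) - Real.log k₁ - Real.log k₂) ^ 2 * ((∑ p ∈ k₁.primeFactors, Real.log p ^ 2) + ∑ p ∈ k₂.primeFactors, Real.log p ^ 2) ^ 2 + 2 * (2 * (Real.log Q - Real.log g) - Real.log k₁ - Real.log k₂)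 ^ 2 * ((∑ p ∈ k₁.primeFactors, Real.log p ^ 4) + ∑ p ∈ k₂.primeFactors, Real.log p ^ 4) + 15 * ((∑ p ∈ k₁.primeFactors, Real.log p ^ 2) + ∑ p ∈ k₂.primeFactors, Real.log p ^ 2) ^ 3 - 30 * ((∑ p ∈ k₁.primeFactors, Real.log p ^ 2) + ∑ p ∈ k₂.primeFactors, Real.log p ^ 2) * ((∑ p ∈ k₁.primeFactors, Real.log p ^ 4) + ∑ p ∈ k₂.primeFactors, Real.log p ^ 4) + 16 * ((∑ p ∈ k₁.primeFactors, Real.log p ^ 6) + ∑ p ∈ k₂.primeFactors, Real.log p ^ 6)) / 64 * ((∫ u₁ in Set.Ioi (0 : ℝ), ∫ u₂ in Set.Ioi (((g : ℝ) ^ 2 / Q ^ 2 * k₁ * k₂) / u₁), Real.exp (-(u₁ + u₂)) / (1 - Real.exp (-(u₁ + u₂))) ^ 2) - (Real.log (1 / ((g : ℝ) ^ 2 / Q ^ 2 * k₁ * k₂)) / 2 + E₀₀)) +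
            ((2 * (Real.log Q - Real.log g) - Real.log k₁ - Real.log k₂) ^ 5 - 2 * (2 * (Real.log Q - Real.log g) - Real.log k₁ - Real.log k₂) ^ 3 * ((∑ p ∈ k₁.primeFactors, Real.log p ^ 2) + ∑ p ∈ k₂.primeFactors, Real.log p ^ 2) + 3 * (2 * (Real.log Q - Real.log g) - Real.log k₁ - Real.log k₂) * ((∑ p ∈ k₁.primeFactors, Real.log p ^ 2) + ∑ p ∈ k₂.primeFactors, Real.log p ^ 2) ^ 2 - 2 * (2 * (Real.log Q - Real.log g) - Real.log k₁ - Real.log k₂) * ((∑ p ∈ k₁.primeFactors, Real.log p ^ 4) + ∑ p ∈ k₂.primeFactors, Real.log p ^ 4)) / 8 * ((∫ u₁ in Set.Ioi (0 : ℝ), ∫ u₂ in Set.Ioi (((g : ℝ) ^ 2 / Q ^ 2 * k₁ * k₂) / u₁), Real.exp (-(u₁ + u₂)) / (1 - Real.exp (-(u₁ + u₂))) ^ 2 * Real.log u₂) - (-(Real.log (1 / ((g : ℝ) ^ 2 / Q ^ 2 * k₁ * k₂)) ^ 2) / 8 + E₀₁)) +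
            (3 * (2 * (Real.log Q - Real.log g) - Real.log k₁ - Real.log k₂) ^ 4 - 6 * (2 * (Real.log Q - Real.log g) - Real.log k₁ - Real.log k₂) ^ 2 * ((∑ p ∈ k₁.primeFactors, Real.log p ^ 2) + ∑ p ∈ k₂.primeFactors, Real.log p ^ 2) + 9 * ((∑ p ∈ k₁.primeFactors, Real.log p ^ 2) + ∑ p ∈ k₂.primeFactors, Real.log p ^ 2) ^ 2 - 6 * ((∑ p ∈ k₁.primeFactors, Real.log p ^ 4) + ∑ p ∈ k₂.primeFactors, Real.log p ^ 4)) / 8 * ((∫ u₁ in Set.Ioi (0 : ℝ), ∫ u₂ in Set.Ioi (((g : ℝ) ^ 2 / Q ^ 2 * k₁ * k₂) / u₁), Real.exp (-(u₁ + u₂)) / (1 - Real.exp (-(u₁ + u₂))) ^ 2 * Real.log u₂ ^ 2) - (Real.log (1 / ((g : ℝ) ^ 2 / Q ^ 2 * k₁ * k₂)) ^ 3 / 24 + 2 * μ₂ * Real.log (1 / ((g : ℝ) ^ 2 / Q ^ 2 * k₁ * k₂)) + E₀₂)) +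
            ((2 * (Real.log Q - Real.log g) - Real.log k₁ - Real.log k₂) ^ 3 - (2 * (Real.log Q - Real.log g) - Real.log k₁ - Real.log k₂) * ((∑ p ∈ k₁.primeFactors, Real.log p ^ 2) + ∑ p ∈ k₂.primeFactors, Real.log p ^ 2)) / 2 * ((∫ u₁ in Set.Ioi (0 : ℝ), ∫ u₂ in Set.Ioi (((g : ℝ) ^ 2 / Q ^ 2 * k₁ * k₂) / u₁), Real.exp (-(u₁ + u₂)) / (1 - Real.exp (-(u₁ + u₂))) ^ 2 * Real.log u₂ ^ 3) - (-(Real.log (1 / ((g : ℝ) ^ 2 / Q ^ 2 * k₁ * k₂)) ^ 4) / 64 - 3 * μ₂ / 2 * Real.log (1 / ((g : ℝ) ^ 2 / Q ^ 2 * k₁ * k₂)) ^ 2 + E₀₃)) +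
            ((2 * (Real.log Q - Real.log g) - Real.log k₁ - Real.log k₂) ^ 2 + ((∑ p ∈ k₁.primeFactors, Real.log p ^ 2) + ∑ p ∈ k₂.primeFactors, Real.log p ^ 2)) / 4 * ((∫ u₁ in Set.Ioi (0 : ℝ), ∫ u₂ in Set.Ioi (((g : ℝ) ^ 2 / Q ^ 2 * k₁ * k₂) / u₁), Real.exp (-(u₁ + u₂)) / (1 - Real.exp (-(u₁ + u₂))) ^ 2 * Real.log u₂ ^ 4) - (Real.log (1 / ((g : ℝ) ^ 2 / Q ^ 2 * k₁ * k₂)) ^ 5 / 160 + μ₂ * Real.log (1 / ((g : ℝ) ^ 2 / Q ^ 2 * k₁ * k₂)) ^ 3 + 2 * μ₄ * Real.log (1 / ((g : ℝ) ^ 2 / Q ^ 2 * k₁ * k₂)) + E₀₄)) +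
            ((2 * (Real.log Q - Real.log g) - Real.log k₁ - Real.log k₂) ^ 5 + 2 * (2 * (Real.log Q - Real.log g) - Real.log k₁ - Real.log k₂) ^ 3 * ((∑ p ∈ k₁.primeFactors, Real.log p ^ 2) + ∑ p ∈ k₂.primeFactors, Real.log p ^ 2) - 9 * (2 * (Real.log Q - Real.log g) - Real.log k₁ - Real.log k₂) * ((∑ p ∈ k₁.primeFactors, Real.log p ^ 2) + ∑ p ∈ k₂.primeFactors, Real.log p ^ 2) ^ 2 + 6 * (2 * (Real.log Q - Real.log g) - Real.log k₁ - Real.log k₂) * ((∑ p ∈ k₁.primeFactors, Real.log p ^ 4) + ∑ p ∈ k₂.primeFactors, Real.log p ^ 4)) / 16 * ((∫ u₁ in Set.Ioi (0 : ℝ), Real.log u₁ * ∫ u₂ in Set.Ioi (((g : ℝ) ^ 2 / Q ^ 2 * k₁ * k₂) / u₁), Real.exp (-(u₁ + u₂)) / (1 - Real.exp (-(u₁ + u₂))) ^ 2) - (-(Real.log (1 / ((g : ℝ) ^ 2 / Q ^ 2 * k₁ * k₂)) ^ 2) / 8 + E₁₀)) +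
            ((2 * (Real.log Q - Real.log g) - Real.log k₁ - Real.log k₂) ^ 4 - 3 * ((∑ p ∈ k₁.primeFactors, Real.log p ^ 2) + ∑ p ∈ k₂.primeFactors, Real.log p ^ 2) ^ 2 + 2 * ((∑ p ∈ k₁.primeFactors, Real.log p ^ 4) + ∑ p ∈ k₂.primeFactors, Real.log p ^ 4)) / 2 * ((∫ u₁ in Set.Ioi (0 : ℝ), Real.log u₁ * ∫ u₂ in Set.Ioi (((g : ℝ) ^ 2 / Q ^ 2 * k₁ * k₂) / u₁), Real.exp (-(u₁ + u₂)) / (1 - Real.exp (-(u₁ + u₂))) ^ 2 * Real.log u₂) - (Real.log (1 / ((g : ℝ) ^ 2 / Q ^ 2 * k₁ * k₂)) ^ 3 / 24 - 2 * μ₂ * Real.log (1 / ((g : ℝ) ^ 2 / Q ^ 2 * k₁ * k₂)) + E₁₁)) +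
            (3 * (2 * (Real.log Q - Real.log g) - Real.log k₁ - Real.log k₂) ^ 3 - 3 * (2 * (Real.log Q - Real.log g) - Real.log k₁ - Real.log k₂) * ((∑ p ∈ k₁.primeFactors, Real.log p ^ 2) + ∑ p ∈ k₂.primeFactors, Real.log p ^ 2)) / 2 * ((∫ u₁ in Set.Ioi (0 : ℝ), Real.log u₁ * ∫ u₂ in Set.Ioi (((g : ℝ) ^ 2 / Q ^ 2 * k₁ * k₂) / u₁), Real.exp (-(u₁ + u₂)) / (1 - Real.exp (-(u₁ + u₂))) ^ 2 * Real.log u₂ ^ 2) - (-(Real.log (1 / ((g : ℝ) ^ 2 / Q ^ 2 * k₁ * k₂)) ^ 4) / 64 + μ₂ / 2 * Real.log (1 / ((g : ℝ) ^ 2 / Q ^ 2 * k₁ * k₂)) ^ 2 + E₁₂)) +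
            (2 * (2 * (Real.log Q - Real.log g) - Real.log k₁ - Real.log k₂) ^ 2 - 2 * ((∑ p ∈ k₁.primeFactors, Real.log p ^ 2) + ∑ p ∈ k₂.primeFactors, Real.log p ^ 2)) * ((∫ u₁ in Set.Ioi (0 : ℝ), Real.log u₁ * ∫ u₂ in Set.Ioi (((g : ℝ) ^ 2 / Q ^ 2 * k₁ * k₂) / u₁), Real.exp (-(u₁ + u₂)) / (1 - Real.exp (-(u₁ + u₂))) ^ 2 * Real.log u₂ ^ 3) - (Real.log (1 / ((g : ℝ) ^ 2 / Q ^ 2 * k₁ * k₂)) ^ 5 / 160 - 2 * μ₄ * Real.log (1 / ((g : ℝ) ^ 2 / Q ^ 2 * k₁ * k₂)) + E₁₃)) +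
            (2 * (Real.log Q - Real.log g) - Real.log k₁ - Real.log k₂) * ((∫ u₁ in Set.Ioi (0 : ℝ), Real.log u₁ * ∫ u₂ in Set.Ioi (((g : ℝ) ^ 2 / Q ^ 2 * k₁ * k₂) / u₁), Real.exp (-(u₁ + u₂)) / (1 - Real.exp (-(u₁ + u₂))) ^ 2 * Real.log u₂ ^ 4) - (-(Real.log (1 / ((g : ℝ) ^ 2 / Q ^ 2 * k₁ * k₂)) ^ 6) / 384 - μ₂ / 8 * Real.log (1 / ((g : ℝ) ^ 2 / Q ^ 2 * k₁ * k₂)) ^ 4 + 3 * μ₄ / 2 * Real.log (1 / ((g : ℝ) ^ 2 / Q ^ 2 * k₁ * k₂)) ^ 2 + E₁₄)) +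
            ((2 * (Real.log Q - Real.log g) - Real.log k₁ - Real.log k₂) ^ 4 + 6 * (2 * (Real.log Q - Real.log g) - Real.log k₁ - Real.log k₂) ^ 2 * ((∑ p ∈ k₁.primeFactors, Real.log p ^ 2) + ∑ p ∈ k₂.primeFactors, Real.log p ^ 2) + 3 * ((∑ p ∈ k₁.primeFactors, Real.log p ^ 2) + ∑ p ∈ k₂.primeFactors, Real.log p ^ 2) ^ 2 - 2 * ((∑ p ∈ k₁.primeFactors, Real.log p ^ 4) + ∑ p ∈ k₂.primeFactors, Real.log p ^ 4)) / 16 * ((∫ u₁ in Set.Ioi (0 : ℝ), Real.log u₁ ^ 2 * ∫ u₂ in Set.Ioi (((g : ℝ) ^ 2 / Q ^ 2 * k₁ * k₂) / u₁), Real.exp (-(u₁ + u₂)) / (1 - Real.exp (-(u₁ + u₂))) ^ 2) - (Real.log (1 / ((g : ℝ) ^ 2 / Q ^ 2 * k₁ * k₂)) ^ 3 / 24 + 2 * μ₂ * Real.log (1 / ((g : ℝ) ^ 2 / Q ^ 2 * k₁ * k₂)) + E₂₀)) +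
            ((2 * (Real.log Q - Real.log g) - Real.log k₁ - Real.log k₂) ^ 3 + 3 * (2 * (Real.log Q - Real.log g) - Real.log k₁ - Real.log k₂) * ((∑ p ∈ k₁.primeFactors, Real.log p ^ 2) + ∑ p ∈ k₂.primeFactors, Real.log p ^ 2)) / 2 * ((∫ u₁ in Set.Ioi (0 : ℝ), Real.log u₁ ^ 2 * ∫ u₂ in Set.Ioi (((g : ℝ) ^ 2 / Q ^ 2 * k₁ * k₂) / u₁), Real.exp (-(u₁ + u₂)) / (1 - Real.exp (-(u₁ + u₂))) ^ 2 * Real.log u₂) - (-(Real.log (1 / ((g : ℝ) ^ 2 / Q ^ 2 * k₁ * k₂)) ^ 4) / 64 + μ₂ / 2 * Real.log (1 / ((g : ℝ) ^ 2 / Q ^ 2 * k₁ * k₂)) ^ 2 + E₂₁)) +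
            (3 * (2 * (Real.log Q - Real.log g) - Real.log k₁ - Real.log k₂) ^ 2 + 3 * ((∑ p ∈ k₁.primeFactors, Real.log p ^ 2) + ∑ p ∈ k₂.primeFactors, Real.log p ^ 2)) / 2 * ((∫ u₁ in Set.Ioi (0 : ℝ), Real.log u₁ ^ 2 * ∫ u₂ in Set.Ioi (((g : ℝ) ^ 2 / Q ^ 2 * k₁ * k₂) / u₁), Real.exp (-(u₁ + u₂)) / (1 - Real.exp (-(u₁ + u₂))) ^ 2 * Real.log u₂ ^ 2) - (Real.log (1 / ((g : ℝ) ^ 2 / Q ^ 2 * k₁ * k₂)) ^ 5 / 160 - μ₂ / 3 * Real.log (1 / ((g : ℝ) ^ 2 / Q ^ 2 * k₁ * k₂)) ^ 3 + 2 * μ₄ * Real.log (1 / ((g : ℝ) ^ 2 / Q ^ 2 * k₁ * k₂)) + E₂₂)) + 2 * (2 * (Real.log Q - Real.log g) - Real.log k₁ - Real.log k₂) * ((∫ u₁ in Set.Ioi (0 : ℝ), Real.log u₁ ^ 2 * ∫ u₂ in Set.Ioi (((g : ℝ) ^ 2 / Q ^ 2 * k₁ * k₂) / u₁), Real.exp (-(u₁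 + u₂)) / (1 - Real.exp (-(u₁ + u₂))) ^ 2 * Real.log u₂ ^ 3) - (-(Real.log (1 / ((g : ℝ) ^ 2 / Q ^ 2 * k₁ * k₂)) ^ 6) / 384 + μ₂ / 8 * Real.log (1 / ((g : ℝ) ^ 2 / Q ^ 2 * k₁ * k₂)) ^ 4 - μ₄ / 2 * Real.log (1 / ((g : ℝ) ^ 2 / Q ^ 2 * k₁ * k₂)) ^ 2 + E₂₃)) +
            ((∫ u₁ in Set.Ioi (0 : ℝ), Real.log u₁ ^ 2 * ∫ u₂ in Set.Ioi (((g : ℝ) ^ 2 / Q ^ 2 * k₁ * k₂) / u₁), Real.exp (-(u₁ + u₂)) / (1 - Real.exp (-(u₁ + u₂))) ^ 2 * Real.log u₂ ^ 4) - (Real.log (1 / ((g : ℝ) ^ 2 / Q ^ 2 * k₁ * k₂)) ^ 7 / 896 - μ₂ / 40 * Real.log (1 / ((g : ℝ) ^ 2 / Q ^ 2 * k₁ * k₂)) ^ 5 - μ₄ / 6 * Real.log (1 / ((g : ℝ) ^ 2 / Q ^ 2 * k₁ * k₂)) ^ 3 + 2 * μ₆ * Real.log (1 / ((g : ℝ)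 ^ 2 / Q ^ 2 * k₁ * k₂)) + E₂₄)))| ≤
      C * divWeight n ^ 2 *
        ((1 + 2 * Real.log M + Real.log Q) ^ 16 * Real.sqrt (2 * ((g : ℝ) ^ 2 / Q ^ 2) * K₁ * (M / n)) +
          (1 + 2 * Real.log M + Real.log Q) ^ 16 / (1 + Real.log K₁) ^ 14) := by
  obtain ⟨E₀₀, E₀₁, E₀₂, E₀₃, E₀₄, E₁₀, E₁₁, E₁₂, E₁₃, E₁₄, E₂₀, E₂₁, E₂₂, E₂₃, E₂₄, C₀, hC₀, hTS, hPW⟩ := twoSeq_fifteen₂₄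
  obtain ⟨⟨C₁, hC₁, hBu⟩, ⟨C₂, hC₂, hAu⟩⟩ := And.intro abs_sum_copTauW_le' (abs_sum_copTauW_le_pow 14)
  obtain ⟨CP₀₀, hCP₀₀, hBB₀₀⟩ := abs_bothsided_primeSq_le_pow 14 (show 3 ≤ 8 by norm_num) hC₀
    (hTS _ (Or.inl rfl)) (hPW _ (Or.inl rfl)).1 (hPW _ (Or.inl rfl)).2
  obtain ⟨CP₀₁, hCP₀₁, hBB₀₁⟩ := abs_bothsided_primeSq_le_pow 14 (show 3 ≤ 8 by norm_num) hC₀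
    (hTS _ (Or.inr (Or.inl rfl))) (hPW _ (Or.inr (Or.inl rfl))).1 (hPW _ (Or.inr (Or.inl rfl))).2
  obtain ⟨CP₁₀, hCP₁₀, hBB₁₀⟩ := abs_bothsided_primeSq_le_pow 14 (show 3 ≤ 8 by norm_num) hC₀
    (hTS _ (Or.inr (Or.inr (Or.inr (Or.inr (Or.inr (Or.inl rfl))))))) (hPW _ (Or.inr (Or.inr (Or.inl rfl)))).1 (hPW _ (Or.inr (Or.inr (Or.inl rfl)))).2
  obtain ⟨CP₀₂, hCP₀₂, hBB₀₂⟩ := abs_bothsided_primeSq_le_pow 14 (show 3 ≤ 8 by norm_num) hC₀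
    (hTS _ (Or.inr (Or.inr (Or.inl rfl)))) (hPW _ (Or.inr (Or.inr (Or.inr (Or.inl rfl))))).1 (hPW _ (Or.inr (Or.inr (Or.inr (Or.inl rfl))))).2
  obtain ⟨CP₂₀, hCP₂₀, hBB₂₀⟩ := abs_bothsided_primeSq_le_pow 14 (show 3 ≤ 8 by norm_num) hC₀
    (hTS _ (Or.inr (Or.inr (Or.inr (Or.inr (Or.inr (Or.inr (Or.inr (Or.inr (Or.inr (Or.inr (Or.inl rfl)))))))))))) (hPW _ (Or.inr (Or.inr (Or.inr (Or.inr (Or.inl rfl)))))).1 (hPW _ (Or.inr (Or.inr (Or.inr (Or.inr (Or.inl rfl)))))).2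
  obtain ⟨CP₁₁, hCP₁₁, hBB₁₁⟩ := abs_bothsided_primeSq_le_pow 14 (show 3 ≤ 8 by norm_num) hC₀
    (hTS _ (Or.inr (Or.inr (Or.inr (Or.inr (Or.inr (Or.inr (Or.inl rfl)))))))) (hPW _ (Or.inr (Or.inr (Or.inr (Or.inr (Or.inr rfl)))))).1 (hPW _ (Or.inr (Or.inr (Or.inr (Or.inr (Or.inr rfl)))))).2
  obtain ⟨CQ, hCQ, hBQ⟩ := abs_bothsided_primeSq_decorFour_le_pow 14 (show 3 ≤ 8 by norm_num) hC₀
    (hTS _ (Or.inl rfl)) (hPW _ (Or.inl rfl)).1 (hPW _ (Or.inl rfl)).2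
  set CPm : ℝ := CP₀₀ + CP₀₁ + CP₁₀ + CP₀₂ + CP₂₀ + CP₁₁ with hCPm
  have hCPm0 : 0 ≤ CPm := by rw [hCPm]; positivity
  obtain ⟨eCP₀₀, eCP₀₁, eCP₁₀, eCP₀₂, eCP₂₀, eCP₁₁⟩ : CP₀₀ ≤ CPm ∧ CP₀₁ ≤ CPm ∧ CP₁₀ ≤ CPm ∧ CP₀₂ ≤ CPm ∧ CP₂₀ ≤ CPm ∧ CP₁₁ ≤ CPm := by
    refine ⟨?_, ?_, ?_, ?_, ?_, ?_⟩ <;> (rw [hCPm]; linarith [hCP₀₀, hCP₀₁, hCP₁₀, hCP₀₂, hCP₂₀, hCP₁₁])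
  refine ⟨E₀₀, E₀₁, E₀₂, E₀₃, E₀₄, E₁₀, E₁₁, E₁₂, E₁₃, E₁₄, E₂₀, E₂₁, E₂₂, E₂₃, E₂₄, (∫ v in Set.Ioc (0 : ℝ) 1, Real.log v ^ 2 * (v / (1 + v ^ 2) ^ 2)),
    (∫ v in Set.Ioc (0 : ℝ) 1, Real.log v ^ 4 * (v / (1 + v ^ 2) ^ 2)),
    (∫ v in Set.Ioc (0 : ℝ) 1, Real.log v ^ 6 * (v / (1 + v ^ 2) ^ 2)), fun P hP0 ↦ ?_⟩
  set SP : ℝ := ∑ i ∈ Finset.range (P.natDegree + 1), |P.coeff i| with hSP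
  have hSP0 : 0 ≤ SP := Finset.sum_nonneg fun i _ ↦ abs_nonneg _
  set KKs : ℝ := C₀ * (2187 * C₁ + 420 + 75 + 183 + 45 + 90 * CPm + 60 * CPm ^ 2 + 15 + 20 * CQ) with hKKs
  set KKt : ℝ := 256 * (C₀ * (13122 * C₂ + 2520 * C₂ + 450 * C₂ + 1098 * C₂ + 270 * CPm + 285 * CPm ^ 2 + 95 * CQ)) with hKKt
  obtain ⟨hKKs0, hKKt0⟩ : 0 ≤ KKs ∧ 0 ≤ KKt := ⟨by positivity, by positivity⟩
  set KK : ℝ := KKs + KKt with hKK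
  have hKK0 : 0 ≤ KK := by positivity
  refine ⟨SP ^ 2 * KK + 1, by positivity, fun n g hn hg Q M hQ2 hM2 hnM hgM K₁ hK₁ ↦ ?_⟩
  have hn0 : (0 : ℝ) < n := by exact_mod_cast Nat.pos_of_ne_zero hn
  have hg0 : (0 : ℝ) < g := by exact_mod_cast Nat.pos_of_ne_zero hg
  have hg1 : (1 : ℝ) ≤ g := by exact_mod_cast Nat.one_le_iff_ne_zero.2 hg
  have hQ0 : 0 < Q := by linarith
  have hM0 : 0 < M := by linarith
  set Y : ℝ := M / n with hYdef
  set L : ℝ := Real.log M with hLdef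
  set α : ℝ := (g : ℝ) ^ 2 / Q ^ 2 with hαdef
  have hα : 0 < α := by positivity
  have hY : 1 ≤ Y := by rw [hYdef, le_div_iff₀ hn0]; linarith
  have hY0 : 0 < Y := by linarith only [hY]
  have hYM : Y ≤ M := div_le_self hM0.le (by exact_mod_cast Nat.one_le_iff_ne_zero.2 hn)
  have hL0 : 0 < L := Real.log_pos (by linarith)
  have hLY0 : 0 ≤ Real.log Y := Real.log_nonneg hY
  have hLYL : Real.log Y ≤ L := Real.log_le_log hY0 hYM
  obtain ⟨hlogQ, hlogg0, hloggM⟩ : 0 ≤ Real.log Q ∧ 0 ≤ Real.log g ∧ Real.log g ≤ L :=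
    ⟨Real.log_nonneg (by linarith), Real.log_nonneg hg1, Real.log_le_log hg0 hgM⟩
  set Lam : ℝ := 1 + 2 * Real.log M + Real.log Q with hLamdef
  have hLam1 : 1 ≤ Lam := by rw [hLamdef]; linarith
  have hLam0 : 0 < Lam := by linarith
  set β : ℝ := Real.log Q - Real.log g - Real.log Y with hβdef
  have hβ : |β| ≤ Lam := by
    rw [hβdef, hLamdef, abs_le]; constructor <;> linarith
  have hLYLam : Real.log Y ≤ Lam := by rw [hLamdef]; linarith
  set ly : ℝ := 1 + Real.log Y with hlydef
  have hly0 : 0 ≤ ly := by rw [hlydef]; linarith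
  have hly1 : 1 ≤ ly := by rw [hlydef]; linarith
  have h1LY : ly ≤ Lam := by rw [hlydef, hLamdef]; linarith
  set D : ℝ := divWeight n with hDdef
  have hD1 : 1 ≤ D := one_le_divWeight hn
  have hD0 : 0 ≤ D := divWeight_nonneg n
  set x : ℝ := 1 + |Real.log (2 * α * Y ^ 2)| with hxdef
  have hx1 : 1 ≤ x := by rw [hxdef]; linarith [abs_nonneg (Real.log (2 * α * Y ^ 2))]
  have hx0 : 0 ≤ x := by linarith only [hx1]
  have hxLam : x ≤ 2 * Lam := by
    have hl2 : Real.log 2 < 1 := by have := Real.log_two_lt_d9; linarith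
    have hl2' : 0 < Real.log 2 := Real.log_pos (by norm_num)
    have hlog : Real.log (2 * α * Y ^ 2) = Real.log 2 + (2 * Real.log g - 2 * Real.log Q) + 2 * Real.log Y := by
      rw [hαdef, Real.log_mul (by positivity) (by positivity), Real.log_mul (by norm_num) (by positivity),
        Real.log_pow, Real.log_div (by positivity) (by positivity), Real.log_pow, Real.log_pow]
      push_cast; ring
    rw [hxdef, hlog, hLamdef]
    have := abs_le.2 (⟨by linarith, by linarith⟩ :
      -(1 + 4 * Real.log M + 2 * Real.log Q) ≤ Real.log 2 + (2 * Real.log g - 2 * Real.log Q) + 2 * Real.log Y ∧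
        Real.log 2 + (2 * Real.log g - 2 * Real.log Q) + 2 * Real.log Y ≤ 1 + 4 * Real.log M + 2 * Real.log Q)
    linarith
  have hK0 : 0 ≤ Real.log (K₁ : ℝ) := Real.log_natCast_nonneg K₁
  set K12 : ℝ := (1 + Real.log (K₁ : ℝ)) ^ 14 with hK12def
  have hK12 : 0 < K12 := by positivity
  set s : ℝ := Real.sqrt (2 * α * K₁ * Y) with hsdef
  have hs0 : 0 ≤ s := Real.sqrt_nonneg _
  set Ψ₀ : ℝ := D * (3 * C₀ * C₁ * ly ^ 2 * s + 18 * C₀ * C₂ * ly ^ 2 * x ^ 8 / K12) with hΨ₀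
  set Ψ₂ : ℝ := 3 * C₀ * ly ^ 2 * ly ^ 4 * s + 18 * C₀ * C₂ * D * ly ^ 4 * x ^ 8 / K12 with hΨ₂
  set Ψ₄ : ℝ := 3 * C₀ * ly ^ 2 * (5 * ly ^ 6) * s + 18 * C₀ * C₂ * D * (5 * ly ^ 6) * x ^ 8 / K12 with hΨ₄
  set Ψ₆ : ℝ := 3 * C₀ * ly ^ 2 * (61 * ly ^ 8) * s + 18 * C₀ * C₂ * D * (61 * ly ^ 8) * x ^ 8 / K12 with hΨ₆
  set ΨB : ℝ := C₀ * ((3 * (ly ^ 4 + CPm * D) * ly ^ 4 + 3 * (CPm * D) * (ly ^ 4 + CPm * D) + (CPm * D) ^ 2) * s +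
      (18 * ly ^ 4 * (CPm * D) + 19 * (CPm * D) ^ 2) * x ^ 8 / K12) with hΨB
  set ΨBD : ℝ := C₀ * ((15 * (ly ^ 4 + CQ * D) + 5 * (CQ * D)) * ly ^ 6 * s + 95 * ly ^ 6 * (CQ * D) * x ^ 8 / K12) with hΨBD
  obtain ⟨hΨ₀0, hΨ₂0, hΨ₄0, hΨ₆0, hΨB0, hΨBD0⟩ : 0 ≤ Ψ₀ ∧ 0 ≤ Ψ₂ ∧ 0 ≤ Ψ₄ ∧ 0 ≤ Ψ₆ ∧ 0 ≤ ΨB ∧ 0 ≤ ΨBD :=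
    ⟨by positivity, by positivity, by positivity, by positivity, by positivity, by positivity⟩
  have hηe : ∀ e : ℕ, K₁ ≤ e → |∑ k ∈ Icc 1 e, copTauW n k| ≤ C₂ * D / K12 := by
    intro e he
    rcases Nat.eq_zero_or_pos e with rfl | he0
    · simp only [show Icc (1 : ℕ) 0 = ∅ from Finset.Icc_eq_empty (by norm_num), Finset.sum_empty, abs_zero]
      positivity
    · have h := hAu n hn (e : ℝ) (by exact_mod_cast he0)
      rw [Nat.floor_natCast] at h
      refine h.trans ?_
      have hle : Real.log (K₁ : ℝ) ≤ Real.log (e : ℝ) := by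
        rcases Nat.eq_zero_or_pos K₁ with rfl | hK0'
        · simp only [Nat.cast_zero, Real.log_zero]; exact Real.log_natCast_nonneg e
        · exact Real.log_le_log (by exact_mod_cast hK0') (by exact_mod_cast he)
      apply div_le_div_of_nonneg_left (by positivity) (by positivity)
      exact pow_le_pow_left₀ (by positivity) (by linarith) 14
  have hη0 : 0 ≤ C₂ * D / K12 := by positivity
  have hBa : ∀ e : ℕ, e ≤ ⌊Y⌋₊ → |∑ k ∈ Icc 1 e, copTauW n k| ≤ C₁ * D := by
    intro e _
    rcases Nat.eq_zero_or_pos e with rfl | he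
    · simp only [show Icc (1 : ℕ) 0 = ∅ from Finset.Icc_eq_empty (by norm_num), Finset.sum_empty, abs_zero]
      positivity
    · have := hBu n hn (e : ℝ) (by exact_mod_cast he)
      rwa [Nat.floor_natCast] at this
  have hBaP : ∀ e : ℕ, e ≤ ⌊Y⌋₊ → |∑ k ∈ Icc 1 e, copTauW n k * ∑ p ∈ k.primeFactors, Real.log p ^ 2| ≤ ly ^ 4 :=
    fun e he ↦ abs_sum_copTauW_primeSq_le n hY he
  have hBaD : ∀ e : ℕ, e ≤ ⌊Y⌋₊ → |∑ k ∈ Icc 1 e, copTauW n k *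
      (3 * (∑ p ∈ k.primeFactors, Real.log p ^ 2) ^ 2 - 2 * ∑ p ∈ k.primeFactors, Real.log p ^ 4)| ≤ 5 * ly ^ 6 :=
    fun e he ↦ abs_sum_copTauW_decorFour_le n hY he
  have hSa : ∀ m : ℕ, ∑ k ∈ Icc 1 ⌊Y⌋₊, |copTauW n k| * ellp Y k ^ m ≤ Real.log Y ^ m * ly ^ 2 :=
    fun m ↦ sum_abs_copTauW_mul_ellp_pow_le n m hY
  have hSaP : ∀ m : ℕ, ∑ k ∈ Icc 1 ⌊Y⌋₊, |copTauW n k * ∑ p ∈ k.primeFactors, Real.log p ^ 2| * ellp Y k ^ m ≤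
      Real.log Y ^ m * ly ^ 4 := fun m ↦ sum_abs_copTauW_primeSq_ellp_pow_le n m hY
  have hSaD : ∀ m : ℕ, ∑ k ∈ Icc 1 ⌊Y⌋₊, |copTauW n k *
      (3 * (∑ p ∈ k.primeFactors, Real.log p ^ 2) ^ 2 - 2 * ∑ p ∈ k.primeFactors, Real.log p ^ 4)| * ellp Y k ^ m ≤
      Real.log Y ^ m * (5 * ly ^ 6) := by
    intro m; have := sum_abs_copTauW_decorFour_ellp_pow_le n m hY; linarith
  have hBaS : ∀ e : ℕ, e ≤ ⌊Y⌋₊ → |∑ k ∈ Icc 1 e, copTauW n k *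
      (15 * (∑ p ∈ k.primeFactors, Real.log p ^ 2) ^ 3 - 30 * (∑ p ∈ k.primeFactors, Real.log p ^ 2) *
        (∑ p ∈ k.primeFactors, Real.log p ^ 4) + 16 * ∑ p ∈ k.primeFactors, Real.log p ^ 6)| ≤ 61 * ly ^ 8 :=
    fun e he ↦ abs_sum_copTauW_decorSix_le n hY he
  have hSaS : ∀ m : ℕ, ∑ k ∈ Icc 1 ⌊Y⌋₊, |copTauW n k *
      (15 * (∑ p ∈ k.primeFactors, Real.log p ^ 2) ^ 3 - 30 * (∑ p ∈ k.primeFactors, Real.log p ^ 2) *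
        (∑ p ∈ k.primeFactors, Real.log p ^ 4) + 16 * ∑ p ∈ k.primeFactors, Real.log p ^ 6)| * ellp Y k ^ m ≤
      Real.log Y ^ m * (61 * ly ^ 8) := by
    intro m; have := sum_abs_copTauW_decorSix_ellp_pow_le n m hY; linarith
  have h0 : ∀ R : ℝ → ℝ,
      (R = (fun y : ℝ ↦ ((∫ u₁ in Set.Ioi (0 : ℝ), ∫ u₂ in Set.Ioi (y / u₁), Real.exp (-(u₁ + u₂)) / (1 - Real.exp (-(u₁ + u₂))) ^ 2) - (Real.log (1 / y) / 2 + E₀₀))) ∨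
       R = (fun y : ℝ ↦ ((∫ u₁ in Set.Ioi (0 : ℝ), ∫ u₂ in Set.Ioi (y / u₁), Real.exp (-(u₁ + u₂)) / (1 - Real.exp (-(u₁ + u₂))) ^ 2 * Real.log u₂) - (-(Real.log (1 / y) ^ 2) / 8 + E₀₁))) ∨
       R = (fun y : ℝ ↦ ((∫ u₁ in Set.Ioi (0 : ℝ), ∫ u₂ in Set.Ioi (y / u₁), Real.exp (-(u₁ + u₂)) / (1 - Real.exp (-(u₁ + u₂))) ^ 2 * Real.log u₂ ^ 2) - (Real.log (1 / y) ^ 3 / 24 + 2 * (∫ v in Set.Ioc (0 : ℝ) 1, Real.log v ^ 2 * (v / (1 + v ^ 2) ^ 2)) * Real.log (1 / y) + E₀₂))) ∨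
       R = (fun y : ℝ ↦ ((∫ u₁ in Set.Ioi (0 : ℝ), ∫ u₂ in Set.Ioi (y / u₁), Real.exp (-(u₁ + u₂)) / (1 - Real.exp (-(u₁ + u₂))) ^ 2 * Real.log u₂ ^ 3) - (-(Real.log (1 / y) ^ 4) / 64 - 3 * (∫ v in Set.Ioc (0 : ℝ) 1, Real.log v ^ 2 * (v / (1 + v ^ 2) ^ 2)) / 2 * Real.log (1 / y) ^ 2 + E₀₃))) ∨
       R = (fun y : ℝ ↦ ((∫ u₁ in Set.Ioi (0 : ℝ), ∫ u₂ in Set.Ioi (y / u₁), Real.exp (-(u₁ + u₂)) / (1 - Real.exp (-(u₁ + u₂))) ^ 2 * Real.log u₂ ^ 4) - (Real.log (1 / y) ^ 5 / 160 + (∫ v in Set.Ioc (0 : ℝ) 1, Real.log v ^ 2 * (v / (1 + v ^ 2) ^ 2)) * Real.log (1 / y) ^ 3 + 2 * (∫ v in Set.Ioc (0 : ℝ) 1, Real.log v ^ 4 * (v / (1 + v ^ 2) ^ 2)) * Real.log (1 / y) + E₀₄))) ∨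
       R = (fun y : ℝ ↦ ((∫ u₁ in Set.Ioi (0 : ℝ), Real.log u₁ * ∫ u₂ in Set.Ioi (y / u₁), Real.exp (-(u₁ + u₂)) / (1 - Real.exp (-(u₁ + u₂))) ^ 2) - (-(Real.log (1 / y) ^ 2) / 8 + E₁₀))) ∨
       R = (fun y : ℝ ↦ ((∫ u₁ in Set.Ioi (0 : ℝ), Real.log u₁ * ∫ u₂ in Set.Ioi (y / u₁), Real.exp (-(u₁ + u₂)) / (1 - Real.exp (-(u₁ + u₂))) ^ 2 * Real.log u₂) - (Real.log (1 / y) ^ 3 / 24 - 2 * (∫ v in Set.Ioc (0 : ℝ) 1, Real.log v ^ 2 * (v / (1 + v ^ 2) ^ 2)) * Real.log (1 / y) + E₁₁))) ∨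
       R = (fun y : ℝ ↦ ((∫ u₁ in Set.Ioi (0 : ℝ), Real.log u₁ * ∫ u₂ in Set.Ioi (y / u₁), Real.exp (-(u₁ + u₂)) / (1 - Real.exp (-(u₁ + u₂))) ^ 2 * Real.log u₂ ^ 2) - (-(Real.log (1 / y) ^ 4) / 64 + (∫ v in Set.Ioc (0 : ℝ) 1, Real.log v ^ 2 * (v / (1 + v ^ 2) ^ 2)) / 2 * Real.log (1 / y) ^ 2 + E₁₂))) ∨
       R = (fun y : ℝ ↦ ((∫ u₁ in Set.Ioi (0 : ℝ), Real.log u₁ * ∫ u₂ in Set.Ioi (y / u₁), Real.exp (-(u₁ + u₂)) / (1 - Real.exp (-(u₁ + u₂))) ^ 2 * Real.log u₂ ^ 3) - (Real.log (1 / y) ^ 5 / 160 - 2 * (∫ v in Set.Ioc (0 : ℝ) 1, Real.log v ^ 4 * (v / (1 + v ^ 2) ^ 2)) * Real.log (1 / y) + E₁₃))) ∨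
       R = (fun y : ℝ ↦ ((∫ u₁ in Set.Ioi (0 : ℝ), Real.log u₁ * ∫ u₂ in Set.Ioi (y / u₁), Real.exp (-(u₁ + u₂)) / (1 - Real.exp (-(u₁ + u₂))) ^ 2 * Real.log u₂ ^ 4) - (-(Real.log (1 / y) ^ 6) / 384 - (∫ v in Set.Ioc (0 : ℝ) 1, Real.log v ^ 2 * (v / (1 + v ^ 2) ^ 2)) / 8 * Real.log (1 / y) ^ 4 + 3 * (∫ v in Set.Ioc (0 : ℝ) 1, Real.log v ^ 4 * (v / (1 + v ^ 2) ^ 2)) / 2 * Real.log (1 / y) ^ 2 + E₁₄))) ∨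
       R = (fun y : ℝ ↦ ((∫ u₁ in Set.Ioi (0 : ℝ), Real.log u₁ ^ 2 * ∫ u₂ in Set.Ioi (y / u₁), Real.exp (-(u₁ + u₂)) / (1 - Real.exp (-(u₁ + u₂))) ^ 2) - (Real.log (1 / y) ^ 3 / 24 + 2 * (∫ v in Set.Ioc (0 : ℝ) 1, Real.log v ^ 2 * (v / (1 + v ^ 2) ^ 2)) * Real.log (1 / y) + E₂₀))) ∨
       R = (fun y : ℝ ↦ ((∫ u₁ in Set.Ioi (0 : ℝ), Real.log u₁ ^ 2 * ∫ u₂ in Set.Ioi (y / u₁), Real.exp (-(u₁ + u₂)) / (1 - Real.exp (-(u₁ + u₂))) ^ 2 * Real.log u₂) - (-(Real.log (1 / y) ^ 4) / 64 + (∫ v in Set.Ioc (0 : ℝ) 1, Real.log v ^ 2 * (v / (1 + v ^ 2) ^ 2)) / 2 * Real.log (1 / y) ^ 2 + E₂₁))) ∨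
       R = (fun y : ℝ ↦ ((∫ u₁ in Set.Ioi (0 : ℝ), Real.log u₁ ^ 2 * ∫ u₂ in Set.Ioi (y / u₁), Real.exp (-(u₁ + u₂)) / (1 - Real.exp (-(u₁ + u₂))) ^ 2 * Real.log u₂ ^ 2) - (Real.log (1 / y) ^ 5 / 160 - (∫ v in Set.Ioc (0 : ℝ) 1, Real.log v ^ 2 * (v / (1 + v ^ 2) ^ 2)) / 3 * Real.log (1 / y) ^ 3 + 2 * (∫ v in Set.Ioc (0 : ℝ) 1, Real.log v ^ 4 * (v / (1 + v ^ 2) ^ 2)) * Real.log (1 / y) + E₂₂))) ∨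
       R = (fun y : ℝ ↦ ((∫ u₁ in Set.Ioi (0 : ℝ), Real.log u₁ ^ 2 * ∫ u₂ in Set.Ioi (y / u₁), Real.exp (-(u₁ + u₂)) / (1 - Real.exp (-(u₁ + u₂))) ^ 2 * Real.log u₂ ^ 3) - (-(Real.log (1 / y) ^ 6) / 384 + (∫ v in Set.Ioc (0 : ℝ) 1, Real.log v ^ 2 * (v / (1 + v ^ 2) ^ 2)) / 8 * Real.log (1 / y) ^ 4 - (∫ v in Set.Ioc (0 : ℝ) 1, Real.log v ^ 4 * (v / (1 + v ^ 2) ^ 2)) / 2 * Real.log (1 / y) ^ 2 + E₂₃))) ∨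
       R = (fun y : ℝ ↦ ((∫ u₁ in Set.Ioi (0 : ℝ), Real.log u₁ ^ 2 * ∫ u₂ in Set.Ioi (y / u₁), Real.exp (-(u₁ + u₂)) / (1 - Real.exp (-(u₁ + u₂))) ^ 2 * Real.log u₂ ^ 4) - (Real.log (1 / y) ^ 7 / 896 - (∫ v in Set.Ioc (0 : ℝ) 1, Real.log v ^ 2 * (v / (1 + v ^ 2) ^ 2)) / 40 * Real.log (1 / y) ^ 5 - (∫ v in Set.Ioc (0 : ℝ) 1, Real.log v ^ 4 * (v / (1 + v ^ 2) ^ 2)) / 6 * Real.log (1 / y) ^ 3 + 2 * (∫ v in Set.Ioc (0 : ℝ) 1, Real.log v ^ 6 * (v / (1 + v ^ 2) ^ 2)) * Real.log (1 / y) + E₂₄)))) →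
      ∀ i j : ℕ, 1 ≤ i → 1 ≤ j →
      |∑ k₁ ∈ Icc 1 ⌊Y⌋₊, ∑ k₂ ∈ Icc 1 ⌊Y⌋₊,
          copTauW n k₁ * copTauW n k₂ * ellp Y k₁ ^ i * ellp Y k₂ ^ j * R (α * k₁ * k₂)| ≤ Real.log Y ^ (i + j) * Ψ₀ := by
    intro R hRR i j hi hj
    refine (hTS R hRR (copTauW n) (copTauW n) Y α (C₁ * D) (C₂ * D / K12) K₁ i j hY hα hi hj hBa hηe hK₁).trans ?_
    obtain ⟨hLi, hLj⟩ : 0 ≤ Real.log Y ^ i ∧ 0 ≤ Real.log Y ^ j := ⟨pow_nonneg hLY0 i, pow_nonneg hLY0 j⟩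
    have p1 : 0 ≤ C₁ * D * (Real.log Y ^ j * (3 * C₀ * s)) := by positivity
    have p2 : 0 ≤ (2 * (C₂ * D / K12)) * (Real.log Y ^ i * (9 * C₀ * x ^ 8)) := by positivity
    calc _ ≤ (Real.log Y ^ i * ly ^ 2) * (C₁ * D * (Real.log Y ^ j * (3 * C₀ * s))) +
          (Real.log Y ^ j * ly ^ 2) * ((2 * (C₂ * D / K12)) * (Real.log Y ^ i * (9 * C₀ * x ^ 8))) :=
          add_le_add (mul_le_mul_of_nonneg_right (hSa i) p1) (mul_le_mul_of_nonneg_right (hSa j) p2)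
      _ = Real.log Y ^ (i + j) * Ψ₀ := by rw [hΨ₀, pow_add]; field_simp; ring
  have h2 : ∀ R : ℝ → ℝ,
      (R = (fun y : ℝ ↦ ((∫ u₁ in Set.Ioi (0 : ℝ), ∫ u₂ in Set.Ioi (y / u₁), Real.exp (-(u₁ + u₂)) / (1 - Real.exp (-(u₁ + u₂))) ^ 2) - (Real.log (1 / y) / 2 + E₀₀))) ∨
       R = (fun y : ℝ ↦ ((∫ u₁ in Set.Ioi (0 : ℝ), ∫ u₂ in Set.Ioi (y / u₁), Real.exp (-(u₁ + u₂)) / (1 - Real.exp (-(u₁ + u₂))) ^ 2 * Real.log u₂) - (-(Real.log (1 / y) ^ 2) / 8 + E₀₁))) ∨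
       R = (fun y : ℝ ↦ ((∫ u₁ in Set.Ioi (0 : ℝ), ∫ u₂ in Set.Ioi (y / u₁), Real.exp (-(u₁ + u₂)) / (1 - Real.exp (-(u₁ + u₂))) ^ 2 * Real.log u₂ ^ 2) - (Real.log (1 / y) ^ 3 / 24 + 2 * (∫ v in Set.Ioc (0 : ℝ) 1, Real.log v ^ 2 * (v / (1 + v ^ 2) ^ 2)) * Real.log (1 / y) + E₀₂))) ∨
       R = (fun y : ℝ ↦ ((∫ u₁ in Set.Ioi (0 : ℝ), ∫ u₂ in Set.Ioi (y / u₁), Real.exp (-(u₁ + u₂)) / (1 - Real.exp (-(u₁ + u₂))) ^ 2 * Real.log u₂ ^ 3) - (-(Real.log (1 / y) ^ 4) / 64 - 3 * (∫ v in Set.Ioc (0 : ℝ) 1, Real.log v ^ 2 * (v / (1 + v ^ 2) ^ 2)) / 2 * Real.log (1 / y) ^ 2 + E₀₃))) ∨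
       R = (fun y : ℝ ↦ ((∫ u₁ in Set.Ioi (0 : ℝ), ∫ u₂ in Set.Ioi (y / u₁), Real.exp (-(u₁ + u₂)) / (1 - Real.exp (-(u₁ + u₂))) ^ 2 * Real.log u₂ ^ 4) - (Real.log (1 / y) ^ 5 / 160 + (∫ v in Set.Ioc (0 : ℝ) 1, Real.log v ^ 2 * (v / (1 + v ^ 2) ^ 2)) * Real.log (1 / y) ^ 3 + 2 * (∫ v in Set.Ioc (0 : ℝ) 1, Real.log v ^ 4 * (v / (1 + v ^ 2) ^ 2)) * Real.log (1 / y) + E₀₄))) ∨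
       R = (fun y : ℝ ↦ ((∫ u₁ in Set.Ioi (0 : ℝ), Real.log u₁ * ∫ u₂ in Set.Ioi (y / u₁), Real.exp (-(u₁ + u₂)) / (1 - Real.exp (-(u₁ + u₂))) ^ 2) - (-(Real.log (1 / y) ^ 2) / 8 + E₁₀))) ∨
       R = (fun y : ℝ ↦ ((∫ u₁ in Set.Ioi (0 : ℝ), Real.log u₁ * ∫ u₂ in Set.Ioi (y / u₁), Real.exp (-(u₁ + u₂)) / (1 - Real.exp (-(u₁ + u₂))) ^ 2 * Real.log u₂ ^ 2) - (-(Real.log (1 / y) ^ 4) / 64 + (∫ v in Set.Ioc (0 : ℝ) 1, Real.log v ^ 2 * (v / (1 + v ^ 2) ^ 2)) / 2 * Real.log (1 / y) ^ 2 + E₁₂))) ∨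
       R = (fun y : ℝ ↦ ((∫ u₁ in Set.Ioi (0 : ℝ), Real.log u₁ * ∫ u₂ in Set.Ioi (y / u₁), Real.exp (-(u₁ + u₂)) / (1 - Real.exp (-(u₁ + u₂))) ^ 2 * Real.log u₂ ^ 3) - (Real.log (1 / y) ^ 5 / 160 - 2 * (∫ v in Set.Ioc (0 : ℝ) 1, Real.log v ^ 4 * (v / (1 + v ^ 2) ^ 2)) * Real.log (1 / y) + E₁₃))) ∨
       R = (fun y : ℝ ↦ ((∫ u₁ in Set.Ioi (0 : ℝ), Real.log u₁ ^ 2 * ∫ u₂ in Set.Ioi (y / u₁), Real.exp (-(u₁ + u₂)) / (1 - Real.exp (-(u₁ + u₂))) ^ 2) - (Real.log (1 / y) ^ 3 / 24 + 2 * (∫ v in Set.Ioc (0 : ℝ) 1, Real.log v ^ 2 * (v / (1 + v ^ 2) ^ 2)) * Real.log (1 / y) + E₂₀))) ∨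
       R = (fun y : ℝ ↦ ((∫ u₁ in Set.Ioi (0 : ℝ), Real.log u₁ ^ 2 * ∫ u₂ in Set.Ioi (y / u₁), Real.exp (-(u₁ + u₂)) / (1 - Real.exp (-(u₁ + u₂))) ^ 2 * Real.log u₂) - (-(Real.log (1 / y) ^ 4) / 64 + (∫ v in Set.Ioc (0 : ℝ) 1, Real.log v ^ 2 * (v / (1 + v ^ 2) ^ 2)) / 2 * Real.log (1 / y) ^ 2 + E₂₁))) ∨
       R = (fun y : ℝ ↦ ((∫ u₁ in Set.Ioi (0 : ℝ), Real.log u₁ ^ 2 * ∫ u₂ in Set.Ioi (y / u₁), Real.exp (-(u₁ + u₂)) / (1 - Real.exp (-(u₁ + u₂))) ^ 2 * Real.log u₂ ^ 2) - (Real.log (1 / y) ^ 5 / 160 - (∫ v in Set.Ioc (0 : ℝ) 1, Real.log v ^ 2 * (v / (1 + v ^ 2) ^ 2)) / 3 * Real.log (1 / y) ^ 3 + 2 * (∫ v in Set.Ioc (0 : ℝ) 1, Real.log v ^ 4 * (v / (1 + v ^ 2) ^ 2)) * Real.log (1 / y) + E₂₂)))) →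
      ∀ i j : ℕ, 1 ≤ i → 1 ≤ j →
      |∑ k₁ ∈ Icc 1 ⌊Y⌋₊, ∑ k₂ ∈ Icc 1 ⌊Y⌋₊,
          copTauW n k₁ * (copTauW n k₂ * ∑ p ∈ k₂.primeFactors, Real.log p ^ 2) * ellp Y k₁ ^ i * ellp Y k₂ ^ j *
            R (α * k₁ * k₂)| ≤ Real.log Y ^ (i + j) * Ψ₂ := by
    intro R hRR i j hi hj
    obtain ⟨hLi, hLj⟩ : 0 ≤ Real.log Y ^ i ∧ 0 ≤ Real.log Y ^ j := ⟨pow_nonneg hLY0 i, pow_nonneg hLY0 j⟩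
    have p1 : 0 ≤ ly ^ 4 * (Real.log Y ^ j * (3 * C₀ * s)) := by positivity
    have p2 : 0 ≤ (2 * (C₂ * D / K12)) * (Real.log Y ^ i * (9 * C₀ * x ^ 8)) := by positivity
    refine (hTS R ?_ (copTauW n) (fun k ↦ copTauW n k * ∑ p ∈ k.primeFactors, Real.log p ^ 2) Y α (ly ^ 4)
      (C₂ * D / K12) K₁ i j hY hα hi hj hBaP hηe hK₁).trans ?_
    · rcases hRR with h | h | h | h | h | h | h | h | h | h | h
      · exact (Or.inl h)
      · exact (Or.inr (Or.inl h))
      · exact (Or.inr (Or.inr (Or.inl h)))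
      · exact (Or.inr (Or.inr (Or.inr (Or.inl h))))
      · exact (Or.inr (Or.inr (Or.inr (Or.inr (Or.inl h)))))
      · exact (Or.inr (Or.inr (Or.inr (Or.inr (Or.inr (Or.inl h))))))
      · exact (Or.inr (Or.inr (Or.inr (Or.inr (Or.inr (Or.inr (Or.inr (Or.inl h))))))))
      · exact (Or.inr (Or.inr (Or.inr (Or.inr (Or.inr (Or.inr (Or.inr (Or.inr (Or.inl h)))))))))
      · exact (Or.inr (Or.inr (Or.inr (Or.inr (Or.inr (Or.inr (Or.inr (Or.inr (Or.inr (Or.inr (Or.inl h)))))))))))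
      · exact (Or.inr (Or.inr (Or.inr (Or.inr (Or.inr (Or.inr (Or.inr (Or.inr (Or.inr (Or.inr (Or.inr (Or.inl h))))))))))))
      · exact (Or.inr (Or.inr (Or.inr (Or.inr (Or.inr (Or.inr (Or.inr (Or.inr (Or.inr (Or.inr (Or.inr (Or.inr (Or.inl h)))))))))))))
    calc _ ≤ (Real.log Y ^ i * ly ^ 2) * (ly ^ 4 * (Real.log Y ^ j * (3 * C₀ * s))) +
          (Real.log Y ^ j * (ly ^ 4)) * ((2 * (C₂ * D / K12)) * (Real.log Y ^ i * (9 * C₀ * x ^ 8))) :=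
          add_le_add (mul_le_mul_of_nonneg_right (hSa i) p1) (mul_le_mul_of_nonneg_right (hSaP j) p2)
      _ = Real.log Y ^ (i + j) * Ψ₂ := by rw [hΨ₂, pow_add]; field_simp; ring
  have h4 : ∀ R : ℝ → ℝ,
      (R = (fun y : ℝ ↦ ((∫ u₁ in Set.Ioi (0 : ℝ), ∫ u₂ in Set.Ioi (y / u₁), Real.exp (-(u₁ + u₂)) / (1 - Real.exp (-(u₁ + u₂))) ^ 2) - (Real.log (1 / y) / 2 + E₀₀))) ∨
       R = (fun y : ℝ ↦ ((∫ u₁ in Set.Ioi (0 : ℝ), ∫ u₂ in Set.Ioi (y / u₁), Real.exp (-(u₁ + u₂)) / (1 - Real.exp (-(u₁ + u₂))) ^ 2 * Real.log u₂) - (-(Real.log (1 / y) ^ 2) / 8 + E₀₁))) ∨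
       R = (fun y : ℝ ↦ ((∫ u₁ in Set.Ioi (0 : ℝ), ∫ u₂ in Set.Ioi (y / u₁), Real.exp (-(u₁ + u₂)) / (1 - Real.exp (-(u₁ + u₂))) ^ 2 * Real.log u₂ ^ 2) - (Real.log (1 / y) ^ 3 / 24 + 2 * (∫ v in Set.Ioc (0 : ℝ) 1, Real.log v ^ 2 * (v / (1 + v ^ 2) ^ 2)) * Real.log (1 / y) + E₀₂))) ∨
       R = (fun y : ℝ ↦ ((∫ u₁ in Set.Ioi (0 : ℝ), Real.log u₁ * ∫ u₂ in Set.Ioi (y / u₁), Real.exp (-(u₁ + u₂)) / (1 - Real.exp (-(u₁ + u₂))) ^ 2) - (-(Real.log (1 / y) ^ 2) / 8 + E₁₀))) ∨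
       R = (fun y : ℝ ↦ ((∫ u₁ in Set.Ioi (0 : ℝ), Real.log u₁ * ∫ u₂ in Set.Ioi (y / u₁), Real.exp (-(u₁ + u₂)) / (1 - Real.exp (-(u₁ + u₂))) ^ 2 * Real.log u₂) - (Real.log (1 / y) ^ 3 / 24 - 2 * (∫ v in Set.Ioc (0 : ℝ) 1, Real.log v ^ 2 * (v / (1 + v ^ 2) ^ 2)) * Real.log (1 / y) + E₁₁))) ∨
       R = (fun y : ℝ ↦ ((∫ u₁ in Set.Ioi (0 : ℝ), Real.log u₁ ^ 2 * ∫ u₂ in Set.Ioi (y / u₁), Real.exp (-(u₁ + u₂)) / (1 - Real.exp (-(u₁ + u₂))) ^ 2) - (Real.log (1 / y) ^ 3 / 24 + 2 * (∫ v in Set.Ioc (0 : ℝ) 1, Real.log v ^ 2 * (v / (1 + v ^ 2) ^ 2)) * Real.log (1 / y) + E₂₀)))) →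
      ∀ i j : ℕ, 1 ≤ i → 1 ≤ j →
      |∑ k₁ ∈ Icc 1 ⌊Y⌋₊, ∑ k₂ ∈ Icc 1 ⌊Y⌋₊,
          copTauW n k₁ * (copTauW n k₂ * (3 * (∑ p ∈ k₂.primeFactors, Real.log p ^ 2) ^ 2 - 2 * ∑ p ∈ k₂.primeFactors, Real.log p ^ 4)) * ellp Y k₁ ^ i * ellp Y k₂ ^ j *
            R (α * k₁ * k₂)| ≤ Real.log Y ^ (i + j) * Ψ₄ := by
    intro R hRR i j hi hj
    obtain ⟨hLi, hLj⟩ : 0 ≤ Real.log Y ^ i ∧ 0 ≤ Real.log Y ^ j := ⟨pow_nonneg hLY0 i, pow_nonneg hLY0 j⟩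
    have p1 : 0 ≤ 5 * ly ^ 6 * (Real.log Y ^ j * (3 * C₀ * s)) := by positivity
    have p2 : 0 ≤ (2 * (C₂ * D / K12)) * (Real.log Y ^ i * (9 * C₀ * x ^ 8)) := by positivity
    refine (hTS R ?_ (copTauW n) (fun k ↦ copTauW n k * (3 * (∑ p ∈ k.primeFactors, Real.log p ^ 2) ^ 2 - 2 * ∑ p ∈ k.primeFactors, Real.log p ^ 4)) Y α (5 * ly ^ 6)
      (C₂ * D / K12) K₁ i j hY hα hi hj hBaD hηe hK₁).trans ?_
    · rcases hRR with h | h | h | h | h | h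
      · exact (Or.inl h)
      · exact (Or.inr (Or.inl h))
      · exact (Or.inr (Or.inr (Or.inl h)))
      · exact (Or.inr (Or.inr (Or.inr (Or.inr (Or.inr (Or.inl h))))))
      · exact (Or.inr (Or.inr (Or.inr (Or.inr (Or.inr (Or.inr (Or.inl h)))))))
      · exact (Or.inr (Or.inr (Or.inr (Or.inr (Or.inr (Or.inr (Or.inr (Or.inr (Or.inr (Or.inr (Or.inl h)))))))))))
    calc _ ≤ (Real.log Y ^ i * ly ^ 2) * (5 * ly ^ 6 * (Real.log Y ^ j * (3 * C₀ * s))) +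
          (Real.log Y ^ j * (5 * ly ^ 6)) * ((2 * (C₂ * D / K12)) * (Real.log Y ^ i * (9 * C₀ * x ^ 8))) :=
          add_le_add (mul_le_mul_of_nonneg_right (hSa i) p1) (mul_le_mul_of_nonneg_right (hSaD j) p2)
      _ = Real.log Y ^ (i + j) * Ψ₄ := by rw [hΨ₄, pow_add]; field_simp; ring
  have h6 : ∀ i j : ℕ, 1 ≤ i → 1 ≤ j →
      |∑ k₁ ∈ Icc 1 ⌊Y⌋₊, ∑ k₂ ∈ Icc 1 ⌊Y⌋₊,
          copTauW n k₁ * (copTauW n k₂ * (15 * (∑ p ∈ k₂.primeFactors, Real.log p ^ 2) ^ 3 - 30 * (∑ p ∈ k₂.primeFactors, Real.log p ^ 2) * (∑ p ∈ k₂.primeFactors, Real.log p ^ 4) + 16 * ∑ p ∈ k₂.primeFactors, Real.log p ^ 6)) * ellp Y k₁ ^ i * ellp Y k₂ ^ j *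
            (fun y : ℝ ↦ ((∫ u₁ in Set.Ioi (0 : ℝ), ∫ u₂ in Set.Ioi (y / u₁), Real.exp (-(u₁ + u₂)) / (1 - Real.exp (-(u₁ + u₂))) ^ 2) - (Real.log (1 / y) / 2 + E₀₀))) (α * k₁ * k₂)| ≤ Real.log Y ^ (i + j) * Ψ₆ := by
    intro i j hi hj
    refine (hTS _ (Or.inl rfl) (copTauW n) (fun k ↦ copTauW n k * (15 * (∑ p ∈ k.primeFactors, Real.log p ^ 2) ^ 3 - 30 * (∑ p ∈ k.primeFactors, Real.log p ^ 2) * (∑ p ∈ k.primeFactors, Real.log p ^ 4) + 16 * ∑ p ∈ k.primeFactors, Real.log p ^ 6))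
      Y α (61 * ly ^ 8) (C₂ * D / K12) K₁ i j hY hα hi hj hBaS hηe hK₁).trans ?_
    obtain ⟨hLi, hLj⟩ : 0 ≤ Real.log Y ^ i ∧ 0 ≤ Real.log Y ^ j := ⟨pow_nonneg hLY0 i, pow_nonneg hLY0 j⟩
    have p1 : 0 ≤ 61 * ly ^ 8 * (Real.log Y ^ j * (3 * C₀ * s)) := by positivity
    have p2 : 0 ≤ (2 * (C₂ * D / K12)) * (Real.log Y ^ i * (9 * C₀ * x ^ 8)) := by positivity
    calc _ ≤ (Real.log Y ^ i * ly ^ 2) * (61 * ly ^ 8 * (Real.log Y ^ j * (3 * C₀ * s))) +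
          (Real.log Y ^ j * (61 * ly ^ 8)) * ((2 * (C₂ * D / K12)) * (Real.log Y ^ i * (9 * C₀ * x ^ 8))) :=
          add_le_add (mul_le_mul_of_nonneg_right (hSa i) p1) (mul_le_mul_of_nonneg_right (hSaS j) p2)
      _ = Real.log Y ^ (i + j) * Ψ₆ := by rw [hΨ₆, pow_add]; field_simp; ring
  have hmonoB : ∀ {CP : ℝ}, 0 ≤ CP → CP ≤ CPm →
      C₀ * ((3 * ((1 + Real.log Y) ^ 4 + CP * divWeight n) * (1 + Real.log Y) ^ 4 +
            3 * (CP * divWeight n) * ((1 + Real.log Y) ^ 4 + CP * divWeight n) + (CP * divWeight n) ^ 2) *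
            Real.sqrt (2 * α * K₁ * Y) +
          (18 * (1 + Real.log Y) ^ 4 * (CP * divWeight n) + 19 * (CP * divWeight n) ^ 2) *
            (1 + |Real.log (2 * α * Y ^ 2)|) ^ 8 / (1 + Real.log K₁) ^ 14) ≤
      C₀ * ((3 * (ly ^ 4 + CPm * D) * ly ^ 4 + 3 * (CPm * D) * (ly ^ 4 + CPm * D) + (CPm * D) ^ 2) * s +
        (18 * ly ^ 4 * (CPm * D) + 19 * (CPm * D) ^ 2) * x ^ 8 / K12) := by
    intro CP hCP hle
    rw [← hlydef, ← hDdef, ← hsdef, ← hxdef, ← hK12def]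
    have hly4 : 0 ≤ ly ^ 4 := by positivity
    gcongr
  have hB : ∀ R : ℝ → ℝ,
      (R = (fun y : ℝ ↦ ((∫ u₁ in Set.Ioi (0 : ℝ), ∫ u₂ in Set.Ioi (y / u₁), Real.exp (-(u₁ + u₂)) / (1 - Real.exp (-(u₁ + u₂))) ^ 2) - (Real.log (1 / y) / 2 + E₀₀))) ∨
       R = (fun y : ℝ ↦ ((∫ u₁ in Set.Ioi (0 : ℝ), ∫ u₂ in Set.Ioi (y / u₁), Real.exp (-(u₁ + u₂)) / (1 - Real.exp (-(u₁ + u₂))) ^ 2 * Real.log u₂) - (-(Real.log (1 / y) ^ 2) / 8 + E₀₁))) ∨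
       R = (fun y : ℝ ↦ ((∫ u₁ in Set.Ioi (0 : ℝ), ∫ u₂ in Set.Ioi (y / u₁), Real.exp (-(u₁ + u₂)) / (1 - Real.exp (-(u₁ + u₂))) ^ 2 * Real.log u₂ ^ 2) - (Real.log (1 / y) ^ 3 / 24 + 2 * (∫ v in Set.Ioc (0 : ℝ) 1, Real.log v ^ 2 * (v / (1 + v ^ 2) ^ 2)) * Real.log (1 / y) + E₀₂))) ∨
       R = (fun y : ℝ ↦ ((∫ u₁ in Set.Ioi (0 : ℝ), Real.log u₁ * ∫ u₂ in Set.Ioi (y / u₁), Real.exp (-(u₁ + u₂)) / (1 - Real.exp (-(u₁ + u₂))) ^ 2) - (-(Real.log (1 / y) ^ 2) / 8 + E₁₀))) ∨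
       R = (fun y : ℝ ↦ ((∫ u₁ in Set.Ioi (0 : ℝ), Real.log u₁ * ∫ u₂ in Set.Ioi (y / u₁), Real.exp (-(u₁ + u₂)) / (1 - Real.exp (-(u₁ + u₂))) ^ 2 * Real.log u₂) - (Real.log (1 / y) ^ 3 / 24 - 2 * (∫ v in Set.Ioc (0 : ℝ) 1, Real.log v ^ 2 * (v / (1 + v ^ 2) ^ 2)) * Real.log (1 / y) + E₁₁))) ∨
       R = (fun y : ℝ ↦ ((∫ u₁ in Set.Ioi (0 : ℝ), Real.log u₁ ^ 2 * ∫ u₂ in Set.Ioi (y / u₁), Real.exp (-(u₁ + u₂)) / (1 - Real.exp (-(u₁ + u₂))) ^ 2) - (Real.log (1 / y) ^ 3 / 24 + 2 * (∫ v in Set.Ioc (0 : ℝ) 1, Real.log v ^ 2 * (v / (1 + v ^ 2) ^ 2)) * Real.log (1 / y) + E₂₀)))) →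
      ∀ i j : ℕ, 1 ≤ i → 1 ≤ j →
      |∑ k₁ ∈ Icc 1 ⌊Y⌋₊, ∑ k₂ ∈ Icc 1 ⌊Y⌋₊,
          (copTauW n k₁ * ∑ p ∈ k₁.primeFactors, Real.log p ^ 2) * (copTauW n k₂ * ∑ p ∈ k₂.primeFactors, Real.log p ^ 2) *
            ellp Y k₁ ^ i * ellp Y k₂ ^ j * R (α * k₁ * k₂)| ≤ Real.log Y ^ (i + j) * ΨB := by
    intro R hRR i j hi hj
    rcases hRR with rfl | rfl | rfl | rfl | rfl | rfl
    · exact (hBB₀₀ n hn Y α K₁ i j hY hα hi hj hK₁).trans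
        (mul_le_mul_of_nonneg_left (by rw [hΨB]; exact hmonoB hCP₀₀ eCP₀₀) (pow_nonneg hLY0 _))
    · exact (hBB₀₁ n hn Y α K₁ i j hY hα hi hj hK₁).trans
        (mul_le_mul_of_nonneg_left (by rw [hΨB]; exact hmonoB hCP₀₁ eCP₀₁) (pow_nonneg hLY0 _))
    · exact (hBB₀₂ n hn Y α K₁ i j hY hα hi hj hK₁).trans
        (mul_le_mul_of_nonneg_left (by rw [hΨB]; exact hmonoB hCP₀₂ eCP₀₂) (pow_nonneg hLY0 _))
    · exact (hBB₁₀ n hn Y α K₁ i j hY hα hi hj hK₁).trans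
        (mul_le_mul_of_nonneg_left (by rw [hΨB]; exact hmonoB hCP₁₀ eCP₁₀) (pow_nonneg hLY0 _))
    · exact (hBB₁₁ n hn Y α K₁ i j hY hα hi hj hK₁).trans
        (mul_le_mul_of_nonneg_left (by rw [hΨB]; exact hmonoB hCP₁₁ eCP₁₁) (pow_nonneg hLY0 _))
    · exact (hBB₂₀ n hn Y α K₁ i j hY hα hi hj hK₁).trans
        (mul_le_mul_of_nonneg_left (by rw [hΨB]; exact hmonoB hCP₂₀ eCP₂₀) (pow_nonneg hLY0 _))
  have hBD : ∀ i j : ℕ, 1 ≤ i → 1 ≤ j →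
      |∑ k₁ ∈ Icc 1 ⌊Y⌋₊, ∑ k₂ ∈ Icc 1 ⌊Y⌋₊,
          (copTauW n k₁ * ∑ p ∈ k₁.primeFactors, Real.log p ^ 2) * (copTauW n k₂ * (3 * (∑ p ∈ k₂.primeFactors, Real.log p ^ 2) ^ 2 - 2 * ∑ p ∈ k₂.primeFactors, Real.log p ^ 4)) *
            ellp Y k₁ ^ i * ellp Y k₂ ^ j * (fun y : ℝ ↦ ((∫ u₁ in Set.Ioi (0 : ℝ), ∫ u₂ in Set.Ioi (y / u₁), Real.exp (-(u₁ + u₂)) / (1 - Real.exp (-(u₁ + u₂))) ^ 2) - (Real.log (1 / y) / 2 + E₀₀))) (α * k₁ * k₂)| ≤ Real.log Y ^ (i + j) * ΨBD := by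
    intro i j hi hj
    refine (hBQ n hn Y α K₁ i j hY hα hi hj hK₁).trans (le_of_eq ?_)
    rw [hΨBD]
  have key := abs_profile_weight_le₂₄ P hP0 hY hLam1 hβ hLYLam hΨ₀0 hΨ₂0 hΨ₄0 hΨ₆0 hΨB0 hΨBD0 hL0 hLYL h0 h2 h4 h6 hB hBD
  have hLk : ∀ k₁ ∈ Icc 1 ⌊Y⌋₊, ∀ k₂ ∈ Icc 1 ⌊Y⌋₊,
      2 * (Real.log Q - Real.log g) - Real.log k₁ - Real.log k₂ = 2 * β + ellp Y k₁ + ellp Y k₂ := by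
    intro k₁ hk₁ k₂ hk₂
    have h1 : (0 : ℝ) < k₁ := by exact_mod_cast (Finset.mem_Icc.1 hk₁).1
    have h2 : (0 : ℝ) < k₂ := by exact_mod_cast (Finset.mem_Icc.1 hk₂).1
    rw [ellp_eq_log hY0.le hk₁, ellp_eq_log hY0.le hk₂, Real.log_div hY0.ne' h1.ne', Real.log_div hY0.ne' h2.ne',
      hβdef]
    ring
  refine le_trans (le_of_eq ?_) (key.trans ?_)
  · exact congrArg abs (Finset.sum_congr rfl fun k₁ hk₁ ↦ Finset.sum_congr rfl fun k₂ hk₂ ↦ by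
      rw [hLk k₁ hk₁ k₂ hk₂])
  have hfin1 : 729 * Lam ^ 6 * Ψ₀ + 140 * Lam ^ 4 * Ψ₂ + 5 * Lam ^ 2 * Ψ₄ + Ψ₆ + 15 * Lam ^ 2 * ΨB + ΨBD ≤
      KKs * (D ^ 2 * (Lam ^ 16 * s)) + KKt * (D ^ 2 * (Lam ^ 16 / K12)) := by
    rw [hΨ₀, hΨ₂, hΨ₄, hΨ₆, hΨB, hΨBD, hKKs, hKKt]
    exact envelope_arith₃₃ hD1 hLam1 hly0 h1LY hx0 hxLam hs0 hK12 hC₀ hC₁.le hC₂.le hCPm0 hCQ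
  clear h0 h2 h4 h6 hB hBD hmonoB key hTS hPW hLk
  have hA0 : 0 ≤ D ^ 2 * (Lam ^ 16 * s) := mul_nonneg (pow_nonneg hD0 2) (mul_nonneg (pow_nonneg hLam0.le 16) hs0)
  have hB0 : 0 ≤ D ^ 2 * (Lam ^ 16 / K12) :=
    mul_nonneg (pow_nonneg hD0 2) (div_nonneg (pow_nonneg hLam0.le 16) hK12.le)
  have hT0 : 0 ≤ D ^ 2 * (Lam ^ 16 * s + Lam ^ 16 / K12) := by rw [mul_add]; exact add_nonneg hA0 hB0
  have h1 : 729 * Lam ^ 6 * Ψ₀ + 140 * Lam ^ 4 * Ψ₂ + 5 * Lam ^ 2 * Ψ₄ + Ψ₆ + 15 * Lam ^ 2 * ΨB + ΨBD ≤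
      KK * (D ^ 2 * (Lam ^ 16 * s + Lam ^ 16 / K12)) := by
    refine hfin1.trans (sub_nonneg.mp ?_)
    have e : KK * (D ^ 2 * (Lam ^ 16 * s + Lam ^ 16 / K12)) -
        (KKs * (D ^ 2 * (Lam ^ 16 * s)) + KKt * (D ^ 2 * (Lam ^ 16 / K12))) =
        KKs * (D ^ 2 * (Lam ^ 16 / K12)) + KKt * (D ^ 2 * (Lam ^ 16 * s)) := by rw [hKK]; ring
    rw [e]; exact add_nonneg (mul_nonneg hKKs0 hB0) (mul_nonneg hKKt0 hA0)
  have h3 : SP ^ 2 * (KK * (D ^ 2 * (Lam ^ 16 * s + Lam ^ 16 / K12))) ≤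
      (SP ^ 2 * KK + 1) * D ^ 2 * (Lam ^ 16 * s + Lam ^ 16 / K12) := by
    have e : (SP ^ 2 * KK + 1) * D ^ 2 * (Lam ^ 16 * s + Lam ^ 16 / K12) =
        SP ^ 2 * (KK * (D ^ 2 * (Lam ^ 16 * s + Lam ^ 16 / K12))) + D ^ 2 * (Lam ^ 16 * s + Lam ^ 16 / K12) := by ring
    rw [e]; exact le_add_of_nonneg_right hT0
  have h4 := (mul_le_mul_of_nonneg_left h1 (sq_nonneg SP)).trans h3
  simpa only [hDdef, hsdef, hSP] using h4

end Summit.Parity.GeneralizedHardyLittlewood.Theorems.MomentsBeyondDiagonal.DiagCorner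

end
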